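import Literature.Topology.PlanarFoliations.ChainLimit
import Literature.Topology.FourManifolds.TautFoliationsPlaqueHomotopy
import Mathlib.Analysis.Normed.Module.Connected
import Mathlib.LinearAlgebra.Complex.FiniteDimensional
import HarnessLib

/-!
# The centre case of the chain limit: compact leaves shrinking to punctures are image-null

Topic: Topology / PlanarFoliations, sequel to `ChainLimit.lean` (the limit set `Dlim` of a
strictly decreasing sequence of compact leaves `K n`). For puncture data `D`:

* `imageNull_of_image_subset_ball` (**proved**): **a compact leaf whose image lies in the ball of
  a puncture is image-null** — its image loop under `g` lies in one plaque of the flow box of the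
  puncture (the level is constant along leafwise maps into the ball), where every loop is
  null-homotopic (`Foliation.homotopic_of_forall_mem_plaque`).
* `Dlim_subset_P_of_frontier` (**proved**): if no point of the domain is a frontier point of the
  limit set, the limit set consists of punctures — its frontier does, and the complement of that
  finite frontier, connected and unbounded, does not meet the interior.
* `false_of_forall_not_mem_frontier` (**proved**): hence **for essential leaves `K n` some point of
  the domain is a frontier point of the limit set** — otherwise the discs, connected, eventually lie
  in a small ball around one puncture and the leaves are image-null.

## References

* C. Camacho, A. Lins Neto, *Geometric Theory of Foliations*, Birkhäuser (1985), Ch. VII §2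
  [CamachoLinsNeto1985].
-/

noncomputable section

open Set Filter Function unitInterval
open _root_.Topology
open Literature.Topology.FourManifolds Literature.Topology.FourManifolds.Foliation Literature.Topology.PlaneTopology

namespace Literature.Topology.PlanarFoliations

variable {X : Type*} [TopologicalSpace X] [T2Space X] [SecondCountableTopology X] {F : Foliation ℝ X} {ι : X → ℂ}
variable {B : Type*} [NormedAddCommGroup B] [NormedSpace ℝ B] {M : Type*} [TopologicalSpace M] {T : Foliation B M} {g : ℂ → M}

namespace PunctureData

variable (D : PunctureData F ι T g)

/-! ## Compact leaves in the ball of a puncture are image-null -/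

/-- **A compact leaf whose image lies in the ball of a puncture is image-null.** [folklore] -/
theorem imageNull_of_image_subset_ball (hbi : IsBiOriented F) {v : ℂ} (hv : v ∈ D.P) {y : X} (hK : IsCompact (F.leaf y))
    (hball : ι '' F.leaf y ⊆ Metric.ball v (D.rad v)) : ImageNull D.foliated y := by
  obtain ⟨γ, hc, hp, hinj, hsurj⟩ := exists_leafLoop_of_isCompact (x := y) hbi hK
  refine ⟨y, γ, hc, hp, F.mem_leaf_self y, hinj, hsurj, ?_⟩
  -- the loop read in `X`, leafwise continuous, with image in the ball
  set γ' : I → X := fun θ ↦ Leaf.pt (γ θ) with hγ'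
  have hγ'c : Continuous (toLeafSpace ∘ γ' : I → F.LeafSpace) := continuous_subtype_val.comp (hc.comp continuous_subtype_val)
  have hγ'ball : ∀ θ, ι (γ' θ) ∈ Metric.ball v (D.rad v) := fun θ ↦ hball ⟨γ' θ, (γ θ).2, rfl⟩
  -- constant level: the image lies in one plaque of the box of `v`
  have hlev : ∀ θ, D.level v (ι (γ' θ)) = D.level v (ι (γ' 0)) := fun θ ↦ D.level_eq_of_preconnectedSpace hv hγ'c hγ'ball θ 0
  have hplaque : ∀ θ, g (ι (γ' θ)) ∈ plaque (D.box v) (D.level v (ι (γ' 0))) := fun θ ↦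
    ⟨D.mapsTo_ball v hv (hγ'ball θ), hlev θ⟩
  -- a loop in one plaque is null-homotopic in the leaf topology
  refine T.homotopic_of_forall_mem_plaque (t := D.level v (ι (γ' 0))) (D.box_mem v hv) _ _ (fun s ↦ ?_) (fun s ↦ ?_)
  · exact hplaque s
  · exact hplaque 0

/-! ## Finite sets: uniform positive bounds -/

omit [T2Space X] [SecondCountableTopology X] [NormedSpace ℝ B] in
/-- A function positive on a finite set has a uniform positive lower bound there. [folklore] -/
theorem exists_pos_le_of_finite {α : Type*} {S : Set α} (hS : S.Finite) {f : α → ℝ} (hf : ∀ a ∈ S, 0 < f a) :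
    ∃ ε > 0, ∀ a ∈ S, ε ≤ f a := by
  induction S, hS using Set.Finite.induction_on with
  | empty => exact ⟨1, one_pos, fun a ha ↦ ha.elim⟩
  | @insert a S _ _ ih =>
    obtain ⟨ε, hε, h⟩ := ih fun b hb ↦ hf b (mem_insert_of_mem _ hb)
    refine ⟨min ε (f a), lt_min hε (hf a (mem_insert _ _)), fun b hb ↦ ?_⟩
    rcases hb with rfl | hb
    · exact min_le_right _ _
    · exact (min_le_left _ _).trans (h b hb)

/-! ## The limit set consists of punctures when no domain point is on its frontier -/

variable (hbi : IsBiOriented F) (hι : IsOpenEmbedding ι) {K : ℕ → X} (hK : ∀ n, IsCompact (F.leaf (K n)))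
  (hdec : ∀ n, discLeaf F ι (K (n + 1)) ⊂ discLeaf F ι (K n))

include hbi hι hK in
omit [NormedSpace ℝ B] in
/-- **If no point of the domain is a frontier point of the limit set, the limit set consists of
punctures.** [folklore] -/
theorem Dlim_subset_P_of_frontier (hΩ : discLeaf F ι (K 0) ⊆ D.Ω) (hfr : ∀ y, ι y ∉ frontier (Dlim ι F K)) : Dlim ι F K ⊆ D.P := by
  have hDcl : IsClosed (Dlim ι F K) := (isCompact_Dlim hbi hι hK).isClosed
  -- the frontier consists of punctures
  have hfrP : frontier (Dlim ι F K) ⊆ D.P := by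
    intro z hz
    have hzΩ : z ∈ D.Ω := hΩ (iInter_subset _ 0 (hDcl.frontier_subset hz))
    by_contra hzP
    obtain ⟨y, rfl⟩ := D.mem_range hzΩ hzP
    exact hfr y hz
  -- the complement of the finite frontier is connected and covered by the interior and the exterior
  set F₀ := frontier (Dlim ι F K) with hF₀
  have hF₀fin : F₀.Finite := D.P_finite.subset hfrP
  have hconn : IsPreconnected F₀ᶜ :=
    (hF₀fin.countable.isPathConnected_compl_of_one_lt_rank (by rw [Complex.rank_real_complex]; norm_num)).isConnected.isPreconnected
  have hcover : F₀ᶜ ⊆ interior (Dlim ι F K) ∪ (Dlim ι F K)ᶜ := by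
    intro z hz
    by_cases hzD : z ∈ Dlim ι F K
    · left
      by_contra hzi
      exact hz ⟨subset_closure hzD, hzi⟩
    · exact Or.inr hzD
  have hdisj : Disjoint (interior (Dlim ι F K)) (Dlim ι F K)ᶜ := disjoint_compl_right.mono_left interior_subset
  rcases hconn.subset_or_subset isOpen_interior hDcl.isOpen_compl hdisj hcover with h | h
  · -- the interior, bounded, would contain the complement of a finite set
    exfalso
    have hbdd : Bornology.IsBounded (interior (Dlim ι F K)) := (isCompact_Dlim hbi hι hK).isBounded.subset interior_subset
    obtain ⟨R, hR⟩ := hbdd.subset_closedBall 0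
    -- infinitely many far points, one of them off the finite frontier
    set S : Set ℂ := range fun k : ℕ ↦ (((|R| + 1 + k : ℝ)) : ℂ) with hS
    have hSinf : S.Infinite := infinite_range_of_injective fun a b hab ↦ by
      have := congrArg Complex.re hab
      simp only [Complex.ofReal_re] at this
      exact_mod_cast (by linarith : (a : ℝ) = b)
    have hnot : ¬ S ⊆ F₀ := fun hsub ↦ hSinf (hF₀fin.subset hsub)
    obtain ⟨z, hzS, hzF⟩ := not_subset.1 hnot
    obtain ⟨k, rfl⟩ := hzS
    have hzin := hR (h hzF)
    rw [Metric.mem_closedBall, dist_zero_right, Complex.norm_real, Real.norm_eq_abs] at hzin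
    have : |(|R| + 1 + k : ℝ)| = |R| + 1 + k := abs_of_nonneg (by positivity)
    rw [this] at hzin
    linarith [le_abs_self R, (k.cast_nonneg : (0 : ℝ) ≤ k)]
  · -- so the limit set is its frontier
    intro z hz
    by_cases hzF : z ∈ F₀
    · exact hfrP hzF
    · exact absurd hz (h hzF)

include hbi hι hK hdec in
/-- **For essential compact leaves with strictly decreasing discs in the region, some point of the
domain is a frontier point of the limit set.** [folklore] -/
theorem false_of_forall_not_mem_frontier (hess : ∀ n, ¬ ImageNull D.foliated (K n)) (hΩ : discLeaf F ι (K 0) ⊆ D.Ω)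
    (hfr : ∀ y, ι y ∉ frontier (Dlim ι F K)) : False := by
  have hDP := D.Dlim_subset_P_of_frontier hbi hι hK hΩ hfr
  -- radii: small disjoint balls around the punctures, inside the balls of the puncture data
  obtain ⟨ε₁, hε₁, hrad⟩ := exists_pos_le_of_finite D.P_finite (f := D.rad) fun p hp ↦ D.rad_pos p hp
  obtain ⟨ε₂, hε₂, hsep⟩ := exists_pos_le_of_finite (D.P_finite.prod D.P_finite |>.subset (fun pq (h : pq ∈ {pq : ℂ × ℂ | pq.1 ∈ D.P ∧ pq.2 ∈ D.P ∧ pq.1 ≠ pq.2}) ↦ ⟨h.1, h.2.1⟩))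
    (f := fun pq : ℂ × ℂ ↦ dist pq.1 pq.2 / 2) fun pq hpq ↦ by exact half_pos (dist_pos.2 hpq.2.2)
  set ε := min ε₁ ε₂ with hε
  have hεpos : 0 < ε := lt_min hε₁ hε₂
  -- the open neighbourhood of the limit set
  set O : Set ℂ := ⋃ p ∈ D.P, Metric.ball p ε with hO
  have hOo : IsOpen O := isOpen_biUnion fun _ _ ↦ Metric.isOpen_ball
  have hDO : Dlim ι F K ⊆ O := fun z hz ↦ mem_biUnion (hDP hz) (Metric.mem_ball_self hεpos)
  -- some disc lies in it
  obtain ⟨n, hn⟩ : ∃ n, discLeaf F ι (K n) ⊆ O := by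
    by_contra h
    push Not at h
    have hne : ∀ n, (discLeaf F ι (K n) \ O).Nonempty := fun n ↦ by
      obtain ⟨z, hz, hzO⟩ := not_subset.1 (h n); exact ⟨z, hz, hzO⟩
    have hI : (⋂ n, (discLeaf F ι (K n) \ O)).Nonempty :=
      IsCompact.nonempty_iInter_of_sequence_nonempty_isCompact_isClosed _ (fun n z hz ↦ ⟨(hdec n).1 hz.1, hz.2⟩) hne
        ((isCompact_discLeaf hbi hι (hK 0)).diff hOo) fun n ↦ (isClosed_discLeaf hbi hι (hK n)).sdiff hOo
    obtain ⟨z, hz⟩ := hI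
    have hzD : z ∈ Dlim ι F K := mem_iInter.2 fun n ↦ (mem_iInter.1 hz n).1
    exact (mem_iInter.1 hz 0).2 (hDO hzD)
  -- the disc, connected, lies in one ball
  obtain ⟨A, hA, hrA, -, hfillA⟩ := exists_isJordanLoop_leaf hbi hι (hK n)
  have hconn : IsPreconnected (discLeaf F ι (K n)) := by
    rw [← hfillA, hA.fill_eq_closure_inside]; exact hA.isPreconnected_closure_inside
  have hpt : ι (K n) ∈ O := hn (image_mem_discLeaf (F.mem_leaf_self _))
  obtain ⟨p, hp, hpball⟩ := mem_iUnion₂.1 hpt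
  set O' : Set ℂ := ⋃ q ∈ D.P \ {p}, Metric.ball q ε with hO'
  have hO'o : IsOpen O' := isOpen_biUnion fun _ _ ↦ Metric.isOpen_ball
  have hcover : discLeaf F ι (K n) ⊆ Metric.ball p ε ∪ O' := by
    intro z hz
    obtain ⟨q, hq, hzq⟩ := mem_iUnion₂.1 (hn hz)
    by_cases hqp : q = p
    · subst hqp; exact Or.inl hzq
    · exact Or.inr (mem_biUnion ⟨hq, hqp⟩ hzq)
  have hdisj : Disjoint (Metric.ball p ε) O' := by
    rw [disjoint_left]
    intro z hz hz'
    obtain ⟨q, ⟨hq, hqp⟩, hzq⟩ := mem_iUnion₂.1 hz'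
    have h2 : ε₂ ≤ dist p q / 2 := hsep (p, q) ⟨hp, hq, Ne.symm hqp⟩
    have h3 : dist p q < ε + ε := (dist_triangle_right p q z).trans_lt (add_lt_add (Metric.mem_ball'.1 hz) (Metric.mem_ball'.1 hzq) |>.trans_eq (by ring))
    have h4 : ε ≤ ε₂ := min_le_right _ _
    linarith
  have hball : discLeaf F ι (K n) ⊆ Metric.ball p ε := by
    rcases hconn.subset_or_subset Metric.isOpen_ball hO'o hdisj hcover with h | h
    · exact h
    · exact absurd (h (image_mem_discLeaf (F.mem_leaf_self _))) (disjoint_left.1 hdisj hpball)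
  -- hence the leaf is image-null
  refine hess n (D.imageNull_of_image_subset_ball hbi hp (hK n) fun z hz ↦ ?_)
  exact Metric.ball_subset_ball ((min_le_left _ _).trans (hrad p hp)) (hball (Or.inl hz))

end PunctureData

end Literature.Topology.PlanarFoliations
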